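import Summits.Ventures.PercRepro.RankLevelSetExplicitLin2KeyL

/-!
# PercRepro — THE LEVEL-16 THEOREM-M ROW OF C-025: THE KEY AT `p = 73 807`, PART A: chunks 1 … 8 of 32 (p4, S4 feed)

`proofs/P4-gen18.md`. The THEOREM-M key `KeyL 16 73807 d` (RankLevelSetExplicitLin2KeyL) at the coranks of the level-16 row
`17 … 16400`, by the kernel (`decide`, 8 chunks of 2 048); the row is assembled in
RankLevelSetExplicitLin2IndepRowSixteen. Axioms: standard.
-/

namespace PercRepro

namespace ThmN

namespace Explicit

/-- The THEOREM-M key row at `(q, p) = (16, 73 807)`, chunk 1 of 32: coranks `17 … 2064`, by the kernel. -/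
theorem key_sixteen_indep_row_1 : ∀ t < 2048, KeyL 16 73807 (17 + t) := by decide +kernel

/-- The THEOREM-M key row at `(q, p) = (16, 73 807)`, chunk 2 of 32: coranks `2065 … 4112`, by the kernel. -/
theorem key_sixteen_indep_row_2 : ∀ t < 2048, KeyL 16 73807 (17 + (2048 + t)) := by decide +kernel

/-- The THEOREM-M key row at `(q, p) = (16, 73 807)`, chunk 3 of 32: coranks `4113 … 6160`, by the kernel. -/
theorem key_sixteen_indep_row_3 : ∀ t < 2048, KeyL 16 73807 (17 + (4096 + t)) := by decide +kernel

/-- The THEOREM-M key row at `(q, p) = (16, 73 807)`, chunk 4 of 32: coranks `6161 … 8208`, by the kernel. -/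
theorem key_sixteen_indep_row_4 : ∀ t < 2048, KeyL 16 73807 (17 + (6144 + t)) := by decide +kernel

/-- The THEOREM-M key row at `(q, p) = (16, 73 807)`, chunk 5 of 32: coranks `8209 … 10256`, by the kernel. -/
theorem key_sixteen_indep_row_5 : ∀ t < 2048, KeyL 16 73807 (17 + (8192 + t)) := by decide +kernel

/-- The THEOREM-M key row at `(q, p) = (16, 73 807)`, chunk 6 of 32: coranks `10257 … 12304`, by the kernel. -/
theorem key_sixteen_indep_row_6 : ∀ t < 2048, KeyL 16 73807 (17 + (10240 + t)) := by decide +kernel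

/-- The THEOREM-M key row at `(q, p) = (16, 73 807)`, chunk 7 of 32: coranks `12305 … 14352`, by the kernel. -/
theorem key_sixteen_indep_row_7 : ∀ t < 2048, KeyL 16 73807 (17 + (12288 + t)) := by decide +kernel

/-- The THEOREM-M key row at `(q, p) = (16, 73 807)`, chunk 8 of 32: coranks `14353 … 16400`, by the kernel. -/
theorem key_sixteen_indep_row_8 : ∀ t < 2048, KeyL 16 73807 (17 + (14336 + t)) := by decide +kernel

end Explicit

end ThmN

end PercRepro
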